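import Summits.ValiantsHypothesis.ValiantsHypothesis.Theorems.LacunarySymmetroidMatrixDescartesCensusV20SoundTerms

/-!
# `MatrixDescartes` census — soundness of the `V = 20` certificate checker: every row the checker builds holds in a model (AM–GM for ≤ 4 terms, `one`/`amgm`/`C25` rows)

HONEST FRAMING.  Object-search cell `pub-symmetroid`; door-A item `DoorA26 = PosRootLawAt 2 6 19`
(stmt-ValiantsHypothesis-19979; OPEN, typed, never asserted).  Part of the proof that a certificate accepted by `V20.checkCell` (`…CensusV20Check`) excludes a twenty — `20 = D(2,6)` distinct
positive det-roots of a six-term real symmetric `2 × 2` pencil — on its support (semantics: `…CensusV20Model`).  Nothing here bears on `V = 19`, on `ζ_sym(2,6)` over all supports, on `DoorA26` itself, on `MatrixDescartes`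
(stmt-ValiantsHypothesis-18050) or on `VP ≠ VNP`.

[folklore] Certificate-checker soundness / replay; elementary.
-/

-- the D-0017 layout repeats a namespace component (single-conjunct summit); the `dupNamespace` linter flags it; name mandated.
set_option linter.dupNamespace false

namespace Summit.ValiantsHypothesis.ValiantsHypothesis.Theorems.LacunarySymmetroidMatrixDescartes.Census.V20

/-! ## Soundness, abstract layer (continued): rows built by the checker hold in a model -/

section Rows

open Finset

variable {dl : List ℕ} {ord : List Atom} {s : Bool} {x : ℕ → ℝ} {v : Atom → ℝ}

/-- `fval []`. [folklore] -/
theorem fval_nil : fval [] = 1 := by simp [fval]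

/-- `fval` of a cons. [folklore] -/
theorem fval_cons (b e : ℕ) (F : FNat) : fval ((b, e) :: F) = b ^ e * fval F := by simp [fval]

/-- `fval` of a singleton. [folklore] -/
theorem fval_singleton (b e : ℕ) : fval [(b, e)] = b ^ e := by simp [fval]

/-- `fval` is multiplicative. [folklore] -/
theorem fval_append (F G : FNat) : fval (F ++ G) = fval F * fval G := by simp [fval]

/-- `fval` with unit exponents. [folklore] -/
theorem fval_map_one (S : List ℕ) (g : ℕ → ℕ) :
    (fval (S.map fun j => (g j, 1)) : ℝ) = (S.map fun j => (g j : ℝ)).prod := by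
  induction S with
  | nil => simp [fval]
  | cons a S ih => rw [List.map_cons, fval_cons, List.map_cons, List.prod_cons, Nat.cast_mul, ih]; simp

/-- `fval` of positive bases is positive. [folklore] -/
theorem fval_pos {F : FNat} (h : ∀ be ∈ F, 0 < be.1) : 0 < fval F := by
  induction F with
  | nil => simp [fval]
  | cons be F ih =>
    obtain ⟨b, e⟩ := be
    rw [fval_cons]
    exact Nat.mul_pos (Nat.pow_pos (h (b, e) (by simp))) (ih fun be hbe => h be (by simp [hbe]))

/-- AM–GM for at most four non-negative reals in the form `m^m ∏ aⱼ ≤ (∑ aⱼ)^m`. [folklore] -/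
theorem amgm_le_four (L : List ℝ) (hL : ∀ a ∈ L, 0 ≤ a) (hlen : L.length ≤ 4) :
    (L.length : ℝ) ^ L.length * L.prod ≤ L.sum ^ L.length := by
  match L, hL, hlen with
  | [], _, _ => simp
  | [a], _, _ => simp
  | [a, b], h, _ =>
    simp only [List.length_cons, List.length_nil, List.prod_cons, List.prod_nil, List.sum_cons, List.sum_nil]
    norm_num
    nlinarith [sq_nonneg (a - b), h a (by simp), h b (by simp)]
  | [a, b, c], h, _ =>
    have ha := h a (by simp); have hb := h b (by simp); have hc := h c (by simp)
    simp only [List.length_cons, List.length_nil, List.prod_cons, List.prod_nil, List.sum_cons, List.sum_nil]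
    norm_num
    have hs : 0 ≤ a + (b + c) := by positivity
    nlinarith [mul_nonneg hs (sq_nonneg (a - b)), mul_nonneg hs (sq_nonneg (b - c)), mul_nonneg hs (sq_nonneg (a - c)),
      mul_nonneg ha (sq_nonneg (b - c)), mul_nonneg hb (sq_nonneg (c - a)), mul_nonneg hc (sq_nonneg (a - b))]
  | [a, b, c, d], h, _ =>
    have ha := h a (by simp); have hb := h b (by simp); have hc := h c (by simp); have hd := h d (by simp)
    simp only [List.length_cons, List.length_nil, List.prod_cons, List.prod_nil, List.sum_cons, List.sum_nil]
    norm_num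
    have hab : 0 ≤ a + b := by positivity
    have hcd : 0 ≤ c + d := by positivity
    have h1 : 4 * (a * b) ≤ (a + b) ^ 2 := by nlinarith [sq_nonneg (a - b)]
    have h2 : 4 * (c * d) ≤ (c + d) ^ 2 := by nlinarith [sq_nonneg (c - d)]
    have h3 : 4 * ((a + b) * (c + d)) ≤ (a + b + (c + d)) ^ 2 := by nlinarith [sq_nonneg (a + b - (c + d))]
    have h4 : 0 ≤ 4 * (a * b) := by positivity
    have h5 : 0 ≤ 4 * (c * d) := by positivity
    calc (256 : ℝ) * (a * (b * (c * d))) = 16 * ((4 * (a * b)) * (4 * (c * d))) := by ring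
      _ ≤ 16 * ((a + b) ^ 2 * (c + d) ^ 2) := by gcongr
      _ = (4 * ((a + b) * (c + d))) ^ 2 := by ring
      _ ≤ ((a + b + (c + d)) ^ 2) ^ 2 := by gcongr
      _ = (a + (b + (c + d))) ^ 4 := by ring
  | _ :: _ :: _ :: _ :: _ :: _, _, hlen => exfalso; simp only [List.length_cons] at hlen; omega

/-- `posIndex` returns the unique positive term of a valid inequality (and, for `RCS`, a definite first letter). [folklore] -/
theorem posIndex_spec {P : PolySpec} {p : ℕ} (h : posIndex ord s P = some p) :
    P.valid = true ∧ posTerms ord s P.poly = [p] ∧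
      (∀ i j, P = .rcs i j → negAt s (posOf (qA i) ord) = false) := by
  unfold posIndex at h
  split_ifs at h with hc
  rw [Bool.and_eq_true] at hc
  refine ⟨hc.1, ?_, ?_⟩
  · split at h
    · next q heq => cases h; exact heq
    · cases h
  · intro i j hP
    subst hP
    simpa [PolySpec.defOK] using hc.2

/-- The positive index is an index. [folklore] -/
theorem lt_length_of_posTerms_eq {P : List Term} {p : ℕ} (hpos : posTerms ord s P = [p]) : p < P.length := by
  have : p ∈ posTerms ord s P := by rw [hpos]; simp
  unfold posTerms at this
  exact List.mem_range.1 (List.mem_filter.1 this).1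

/-- The named inequality holds in the model (for `RCS` given a definite first letter). [folklore] -/
theorem pval_nonneg (M : Model dl ord s x v) (P : PolySpec) (hP : P.valid = true)
    (hdef : ∀ i j, P = .rcs i j → negAt s (posOf (qA i) ord) = false) : 0 ≤ pval v P.poly := by
  cases P with
  | g3 i j k =>
    simp only [PolySpec.valid, decide_eq_true_eq] at hP
    exact M.g3 i j k hP.1 hP.2.1 hP.2.2
  | rcs i j =>
    simp only [PolySpec.valid, decide_eq_true_eq] at hP
    have hq : 0 < v (qA i) := (M.v_qA_pos_iff hP.1).2 (hdef i j rfl)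
    exact M.rcs i j hP.1 hP.2.1 hP.2.2 hq
  | w i j k l =>
    simp only [PolySpec.valid, decide_eq_true_eq] at hP
    obtain ⟨hi, hj, hk, hl, h1, h2, h3, h4, h5, h6⟩ := hP
    exact M.w i j k l hi hj hk hl h1 h2 h3 h4 h5 h6

/-- The single-positive row `|tₙ| ≤ t_p` holds. [folklore] -/
theorem rowOne_holds (M : Model dl ord s x v) {P : PolySpec} {p n : ℕ} (hp : posIndex ord s P = some p)
    (hn : n < P.poly.length) (hnp : n ≠ p) : (rowOne ord P.poly p n).Holds x := by
  obtain ⟨hval, hpos, hdef⟩ := posIndex_spec hp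
  have hP := pval_nonneg M P hval hdef
  obtain ⟨hsum, -⟩ := sum_abs_le_pos M P hval hpos hP [n] (by simpa using ⟨hn, hnp⟩) (List.nodup_singleton n)
  simp only [List.map_cons, List.map_nil, List.sum_cons, List.sum_nil, add_zero] at hsum
  have hpl := lt_length_of_posTerms_eq hpos
  have hTn := atoms_valid P hval _ (term_getD_mem P.poly hn)
  have hTp := atoms_valid P hval _ (term_getD_mem P.poly hpl)
  rw [abs_tval_eq M.xpos M.hv _ hTn] at hsum
  have hpn : termNeg ord s (P.poly.getD p (0, [])) = false := (mem_posTerms_iff hpl).1 (by rw [hpos]; simp)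
  rw [tval_eq_of_not_termNeg M.hv _ hTp hpn] at hsum
  unfold Row.Holds rowOne
  simp only [fval_singleton, pow_one, Nat.cast_natAbs, Int.cast_abs]
  linarith

/-- The AM–GM row holds. [folklore] -/
theorem rowAmgm_holds (M : Model dl ord s x v) {P : PolySpec} {p : ℕ} (hp : posIndex ord s P = some p)
    (S : List ℕ) (hS : ∀ j ∈ S, j < P.poly.length ∧ j ≠ p) (hSnd : S.Nodup) (hS4 : S.length ≤ 4) :
    (rowAmgm ord P.poly p S).Holds x := by
  obtain ⟨hval, hpos, hdef⟩ := posIndex_spec hp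
  have hP := pval_nonneg M P hval hdef
  obtain ⟨hsum, hp0⟩ := sum_abs_le_pos M P hval hpos hP S hS hSnd
  have hpl := lt_length_of_posTerms_eq hpos
  have hTp := atoms_valid P hval _ (term_getD_mem P.poly hpl)
  have hpn : termNeg ord s (P.poly.getD p (0, [])) = false := (mem_posTerms_iff hpl).1 (by rw [hpos]; simp)
  -- abbreviations: `g j` = |coefficient|, `m j` = monomial of absolute values
  set g : ℕ → ℝ := fun j => |((P.poly.getD j (0, [])).1 : ℝ)| with hg
  set m : ℕ → ℝ := fun j => lprod x (posl ord (P.poly.getD j (0, [])).2) with hm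
  have habs : (S.map fun j => |tval v (P.poly.getD j (0, []))|) = S.map fun j => g j * m j := by
    refine List.map_congr_left fun j hj => ?_
    exact abs_tval_eq M.xpos M.hv _ (atoms_valid P hval _ (term_getD_mem P.poly (hS j hj).1))
  rw [habs] at hsum
  have htp : tval v (P.poly.getD p (0, [])) = g p * m p := tval_eq_of_not_termNeg M.hv _ hTp hpn
  rw [htp] at hsum hp0
  -- AM–GM on the list `a_j = g j * m j`
  set A : List ℝ := S.map fun j => g j * m j with hA
  have hAnn : ∀ a ∈ A, 0 ≤ a := by
    intro a ha; rw [hA, List.mem_map] at ha; obtain ⟨j, -, rfl⟩ := ha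
    exact mul_nonneg (abs_nonneg _) (lprod_pos M.xpos _).le
  have hAlen : A.length = S.length := by simp [hA]
  have hmain := amgm_le_four A hAnn (by rw [hAlen]; exact hS4)
  rw [hAlen] at hmain
  have hstep : (S.length : ℝ) ^ S.length * A.prod ≤ (g p * m p) ^ S.length :=
    hmain.trans (pow_le_pow_left₀ (List.sum_nonneg hAnn) hsum _)
  have hAprod : A.prod = (S.map g).prod * (S.map m).prod := by rw [hA, List.prod_map_mul]
  -- the two sides of the row
  have hL : lprod x (rowAmgm ord P.poly p S).L = (S.map m).prod := by
    show lprod x (S.map fun j => posl ord (P.poly.getD j (0, [])).2).flatten = (S.map m).prod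
    rw [lprod_flatten, List.map_map]; rfl
  have hR : lprod x (rowAmgm ord P.poly p S).R = m p ^ S.length := by
    show lprod x (List.replicate S.length (posl ord (P.poly.getD p (0, [])).2)).flatten = m p ^ S.length
    rw [lprod_flatten, List.map_replicate, List.prod_replicate]
  have hBden : (fval (rowAmgm ord P.poly p S).Bden : ℝ) = (S.length : ℝ) ^ S.length * (S.map g).prod := by
    show (fval ((S.length, S.length) :: S.map fun j => ((fun i => (P.poly.getD i (0, [])).1.natAbs) j, 1)) : ℝ)
      = (S.length : ℝ) ^ S.length * (S.map g).prod
    rw [fval_cons, Nat.cast_mul, Nat.cast_pow, fval_map_one]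
    congr 1
    exact congrArg List.prod (List.map_congr_left fun j _ => by rw [Nat.cast_natAbs, Int.cast_abs])
  have hBnum : (fval (rowAmgm ord P.poly p S).Bnum : ℝ) = g p ^ S.length := by
    show (fval [((P.poly.getD p (0, [])).1.natAbs, S.length)] : ℝ) = g p ^ S.length
    rw [fval_singleton]; push_cast; rw [Nat.cast_natAbs, Int.cast_abs]
  unfold Row.Holds
  rw [hL, hR, hBden, hBnum]
  calc (S.map m).prod * ((S.length : ℝ) ^ S.length * (S.map g).prod)
      = (S.length : ℝ) ^ S.length * A.prod := by rw [hAprod]; ring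
    _ ≤ (g p * m p) ^ S.length := hstep
    _ = m p ^ S.length * g p ^ S.length := by ring

/-- `dist1` is positive. [folklore] -/
theorem dist1_pos (a b : ℕ) : 0 < dist1 a b := by
  unfold dist1; split_ifs <;> omega

/-- Every row the checker builds holds in the model and is well formed. [folklore] -/
theorem buildRow_sound (M : Model dl ord s x v) {rs : RowSpec} {r : Row} (h : buildRow dl ord s rs = some r) :
    r.Holds x ∧ r.WF := by
  cases rs with
  | c25 t =>
    simp only [buildRow] at h
    split_ifs at h with ht
    cases h
    refine ⟨M.c25 t ht.1 ht.2, ?_, ?_, ?_, ?_⟩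
    · intro p hp
      simp only [rowC25, List.mem_append, List.mem_replicate] at hp
      omega
    · intro p hp
      simp only [rowC25, List.mem_replicate] at hp
      omega
    · intro be hbe
      simp only [rowC25, List.mem_map] at hbe
      obtain ⟨u, -, rfl⟩ := hbe
      exact dist1_pos _ _
    · intro be hbe
      simp only [rowC25, List.mem_append, List.mem_map] at hbe
      rcases hbe with ⟨u, -, rfl⟩ | ⟨u, -, rfl⟩ <;> exact dist1_pos _ _
  | one P n =>
    simp only [buildRow] at h
    split at h
    · next p hp =>
      split_ifs at h with hn
      cases h
      obtain ⟨hval, hpos, -⟩ := posIndex_spec hp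
      have hpl := lt_length_of_posTerms_eq hpos
      refine ⟨rowOne_holds M hp hn.1 hn.2, ?_, ?_, ?_, ?_⟩
      · exact posl_lt_21 M (atoms_valid P hval _ (term_getD_mem P.poly hn.1))
      · exact posl_lt_21 M (atoms_valid P hval _ (term_getD_mem P.poly hpl))
      · intro be hbe
        simp only [rowOne, List.mem_singleton] at hbe
        subst hbe
        exact Int.natAbs_pos.2 (coeff_ne_zero P _ (term_getD_mem P.poly hpl))
      · intro be hbe
        simp only [rowOne, List.mem_singleton] at hbe
        subst hbe
        exact Int.natAbs_pos.2 (coeff_ne_zero P _ (term_getD_mem P.poly hn.1))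
    · cases h
  | amgm P S =>
    simp only [buildRow] at h
    split at h
    · next p hp =>
      split_ifs at h with hc
      cases h
      simp only [Bool.and_eq_true, decide_eq_true_eq] at hc
      obtain ⟨⟨hS, hSnd⟩, hSne, hS4⟩ := hc
      obtain ⟨hval, hpos, -⟩ := posIndex_spec hp
      have hpl := lt_length_of_posTerms_eq hpos
      refine ⟨rowAmgm_holds M hp S hS hSnd hS4, ?_, ?_, ?_, ?_⟩
      · intro q hq
        simp only [rowAmgm, List.mem_flatten, List.mem_map] at hq
        obtain ⟨l, ⟨j, hj, rfl⟩, hq⟩ := hq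
        exact posl_lt_21 M (atoms_valid P hval _ (term_getD_mem P.poly (hS j hj).1)) q hq
      · intro q hq
        simp only [rowAmgm, List.mem_flatten, List.mem_replicate] at hq
        obtain ⟨l, ⟨-, rfl⟩, hq⟩ := hq
        exact posl_lt_21 M (atoms_valid P hval _ (term_getD_mem P.poly hpl)) q hq
      · intro be hbe
        simp only [rowAmgm, List.mem_singleton] at hbe
        subst hbe
        exact Int.natAbs_pos.2 (coeff_ne_zero P _ (term_getD_mem P.poly hpl))
      · intro be hbe
        simp only [rowAmgm, List.mem_cons, List.mem_map] at hbe
        rcases hbe with rfl | ⟨j, hj, rfl⟩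
        · exact List.length_pos_iff.2 hSne
        · exact Int.natAbs_pos.2 (coeff_ne_zero P _ (term_getD_mem P.poly (hS j hj).1))
    · cases h

end Rows

end Summit.ValiantsHypothesis.ValiantsHypothesis.Theorems.LacunarySymmetroidMatrixDescartes.Census.V20
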